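import Summits.HodgeConjecture.HodgeConjecture.Theorems.Ring2AbelianAllFrame
import Summits.HodgeConjecture.HodgeConjecture.Theorems.Ring2DeformPencilSpreading
import Summits.HodgeConjecture.HodgeConjecture.Theorems.Ring2AbelianAllSpread
import HarnessLib

/-!
# Ring 2 · sub-cell AbelianAll — the FRAME, part II: the SPREADING nodes of both branches placed in the grammar —
# deform XIII's CM-spreading on compact pencils (CPS_CM, CPS_∃: the new bottom of the pencil branch) and the
# Mumford–Tate-family branch (spread-1's S_ZD ⟹ U_Z ⟹ deform's U), with the cross-branch collapse modulo `HC_CM`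

HONEST FRAMING (page 1, verbatim): **research route, not a corollary; conditional on HC_CM plus one named
minimal statement.** Cell line: research route conditional on HC_CM; not a corollary; Q11.4-sentence-2
already refuted in dim ≥ 3. Nothing here proves a case of the Hodge conjecture; every node is somebody's
`@[conjecture]` def used as a HYPOTHESIS; the printed inputs enter as the literature seat's NAMED FACTS
`andre1996_cmAnchoredPencil` (`h₂₁`, André 1996 Lemme 6.3.1) and `deligne1982_cmDenseMumfordTateFamilies` (`hF`,
Deligne 1982 Prop. 6.1 / Charles–Schnell Thm. 11.5.11), binders wherever used; `HC_CM` =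
`Theses.RankFourFaces.CMAbelianHodge` is a binder only. Seat `pub-hodge-ring2-typer1` (cell LEAD), gen 8.
Part I (`Ring2AbelianAllFrame`): the grammar `ClosesWithCM` / `OnPathAV` / `ExactWithCM` / `CMIdle` / `ModCM`, the
least element `CMToAbelian`, the collapse modulo `HC_CM`, and the pencil branch down to (T∃).

## The two branches of the candidate ladder (kernel edges; every arrow a landed theorem, facts marked)

PENCIL branch (André 1996 §6.3; deform IV/VI/XIII, André I/II):
`(1) AbelianSchemeVHC ⟹ (2) ⟹ (3) ⟹ (4) CMAnchoredTransport ⟹ CPS_CM ⟹[h₂₁] CPS_∃ ⟹ CMToAbelian`,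
`(4) ⟹[h₂₁] (T∃) ⟹ CPS_∃` — CPS_∃ = `Ring2.Deform.CMAnchoredPencilCMSpreading` (per Hodge class, SOME 6.3.1-pencil
along which algebraicity spreads out of ALL its CM fibres) is the weakest node of the cell proved sufficient, and it
closes with NO named fact (deform XIII `HC_AV_of_HC_CM_of_cmAnchoredPencilCMSpreading`).
MUMFORD–TATE-FAMILY branch (Deligne 1982 Prop. 6.1; deform I/III/VII, spread-1):
`(1) ⟹ S_ZD SpreadFromZariskiDenseCMPoints ⟹ U_Z SpreadFromZariskiDenseCMLocus ⟹ U UniformAlgebraicityAtCMPoints`,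
each EXACT modulo `hF`, hence `⟹ CMToAbelian` modulo `hF`.
ACROSS the branches NO unconditional edge is in the tree below (1) (pencils are compact one-dimensional bases with a
section; the Mumford–Tate families have quasi-projective bases of any dimension with dense CM locus): the two
branches meet again only modulo `HC_CM` (∧ `h₂₁` ∧ `hF`), where every exact node is `HC_AV` (§C).

| node | `ClosesWithCM` | `OnPathAV` | `CMIdle` | owner |
|---|---|---|---|---|
| CPS_CM `Ring2.Deform.CMPointedPencilCMSpreading` | mod `h₂₁` | yes | not known (kernel or print) | deform XIII |
| CPS_∃ `Ring2.Deform.CMAnchoredPencilCMSpreading` | NO FACT | mod `h₂₁` | not known | deform XIII |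
| S_ZD `SpreadFromZariskiDenseCMPoints` | mod `hF` | yes | not known | spread-1 |
| U_Z `SpreadFromZariskiDenseCMLocus` | mod `hF` | yes | not known | spread-1 |
| U `Ring2.Deform.UniformAlgebraicityAtCMPoints` | mod `hF` | yes | not known | deform VII / III |

References (bib keys): Andre1996Motifs (Lemme 6.3.1 p. 31, §6.3 a) and Remarque 2 p. 33); Abdulali1994FamiliesAV
((1.1), Lemma 6.2); Deligne1982HodgeCycles (Prop. 6.1, Thm. 2.12); CharlesSchnell2014Notes (Conj. 11.3.1, Cor. 11.3.6,
Prop. 11.3.11, Thm. 11.5.11).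
-/

set_option linter.dupNamespace false

namespace Summit.HodgeConjecture.HodgeConjecture.Ring2.AbelianAll

open Literature.AlgebraicGeometry Literature.AlgebraicGeometry.Motives
open Literature.AlgebraicGeometry.HodgeTheory
open Literature.AlgebraicGeometry.Andre1996 (andre1996_cmAnchoredPencil)
open Literature.AlgebraicGeometry.Deligne1982 (deligne1982_cmDenseMumfordTateFamilies)
open Summit.HodgeConjecture.HodgeConjecture
open Summit.HodgeConjecture.HodgeConjecture.Theses
open Summit.HodgeConjecture.HodgeConjecture.Theses.RankFourFaces (CMAbelianHodge CMToAbelian)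
open Summit.HodgeConjecture.HodgeConjecture.Theses.PadicSemiregularLift (HodgeAbelianVarieties)
open Summit.HodgeConjecture.HodgeConjecture.Ring2.Deform (CMPointedPencilCMSpreading CMAnchoredPencilCMSpreading
  UniformAlgebraicityAtCMPoints)

/-! ## §A The pencil-spreading nodes (deform XIII) in the grammar -/

/-- **CPS_∃ closes with NO named fact; CPS_CM closes mod Lemme 6.3.1.** [cite: Andre1996Motifs, §6.3 a) (p. 33)]
[cite: Abdulali1994FamiliesAV, Lemma 6.2 (p. 1131)] -/
theorem closesWithCM_cmSpreading (h₂₁ : andre1996_cmAnchoredPencil) :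
    ClosesWithCM CMAnchoredPencilCMSpreading ∧ ClosesWithCM CMPointedPencilCMSpreading :=
  ⟨fun hCM hT ↦ Ring2.Deform.HC_AV_of_HC_CM_of_cmAnchoredPencilCMSpreading hCM hT,
    fun hCM hS ↦ Ring2.Deform.HC_AV_of_andre1996_of_HC_CM_of_cmPointedPencilCMSpreading h₂₁ hCM hS⟩

/-- The fact-free row on its own: `ClosesWithCM CPS_∃`. [cite: Andre1996Motifs, §6.3 a) (p. 33)] -/
theorem closesWithCM_cmAnchoredPencilCMSpreading : ClosesWithCM CMAnchoredPencilCMSpreading :=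
  fun hCM hT ↦ Ring2.Deform.HC_AV_of_HC_CM_of_cmAnchoredPencilCMSpreading hCM hT

/-- CPS_CM is on-path; CPS_∃ is on-path mod Lemme 6.3.1. [cite: CharlesSchnell2014Notes, Cor. 11.3.6 (p. 494)] -/
theorem onPathAV_cmSpreading (h₂₁ : andre1996_cmAnchoredPencil) :
    OnPathAV CMPointedPencilCMSpreading ∧ OnPathAV CMAnchoredPencilCMSpreading :=
  ⟨Ring2.Deform.cmPointedPencilCMSpreading_of_HC_AV, Ring2.Deform.cmAnchoredPencilCMSpreading_of_andre1996_of_HC_AV h₂₁⟩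

/-- Both spreading nodes are exact mod Lemme 6.3.1 (deform XIII, by name). [cite: Andre1996Motifs, Lemme 6.3.1 (p. 31)] -/
theorem exactWithCM_cmSpreading_of_andre1996 (h₂₁ : andre1996_cmAnchoredPencil) :
    ExactWithCM CMAnchoredPencilCMSpreading ∧ ExactWithCM CMPointedPencilCMSpreading :=
  Ring2.Deform.HC_AV_iff_HC_CM_and_cmSpreadingNodes_of_andre1996 h₂₁

/-- **The bottom of the pencil branch**: `(4) ⟹ CPS_CM`, `CPS_CM ⟹[h₂₁] CPS_∃`, `(T∃) ⟹ CPS_∃`, `CPS_∃ ⟹ CMToAbelian`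
(the last with no fact: least element of part I applied to the fact-free row). [cite: Andre1996Motifs, §6.3 (pp. 31–33)] -/
theorem ladder_spreading (h₂₁ : andre1996_cmAnchoredPencil) :
    (CMAnchoredTransport → CMPointedPencilCMSpreading) ∧
      (CMPointedPencilCMSpreading → CMAnchoredPencilCMSpreading) ∧
      (CMAnchoredPencilTransport → CMAnchoredPencilCMSpreading) ∧ (CMAnchoredPencilCMSpreading → CMToAbelian) :=
  ⟨Ring2.Deform.cmPointedPencilCMSpreading_of_cmAnchoredTransport,
    Ring2.Deform.cmAnchoredPencilCMSpreading_of_andre1996_of_cmPointedPencilCMSpreading h₂₁,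
    Ring2.Deform.cmAnchoredPencilCMSpreading_of_cmAnchoredPencilTransport,
    cmToAbelian_of_closesWithCM closesWithCM_cmAnchoredPencilCMSpreading⟩

/-- Mod Lemme 6.3.1 the item IS "under `HC_CM`, CPS_∃": `ModCM CPS_∃ ↔ CMToAbelian` (part I
`modCM_iff_cmToAbelian_of_exactWithCM`). [cite: Andre1996Motifs, Lemme 6.3.1 (p. 31)] -/
theorem modCM_cmAnchoredPencilCMSpreading_iff_cmToAbelian (h₂₁ : andre1996_cmAnchoredPencil) :
    ModCM CMAnchoredPencilCMSpreading ↔ CMToAbelian :=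
  modCM_iff_cmToAbelian_of_exactWithCM (exactWithCM_cmSpreading_of_andre1996 h₂₁).1

/-! ## §B The Mumford–Tate-family branch (spread-1, deform VII) in the grammar -/

/-- S_ZD, U_Z, U close mod Deligne's family fact `hF`. [cite: Deligne1982HodgeCycles, Prop. 6.1]
[cite: CharlesSchnell2014Notes, Thm. 11.5.11] -/
theorem closesWithCM_spreadAxis (hF : deligne1982_cmDenseMumfordTateFamilies) :
    ClosesWithCM SpreadFromZariskiDenseCMPoints ∧ ClosesWithCM SpreadFromZariskiDenseCMLocus ∧
      ClosesWithCM UniformAlgebraicityAtCMPoints :=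
  ⟨fun hCM hS ↦ HC_AV_of_HC_CM_and_spreadZD hF hCM hS, fun hCM hZ ↦ HC_AV_of_HC_CM_and_spreadZDLocus hF hCM hZ,
    fun hCM hU ↦ Ring2.Deform.HC_AV_of_deligne1982_of_HC_CM_of_uniform hF hCM hU⟩

/-- S_ZD, U_Z, U are on-path (no fact). [cite: CharlesSchnell2014Notes, Cor. 11.3.6 (p. 494)] -/
theorem onPathAV_spreadAxis :
    OnPathAV SpreadFromZariskiDenseCMPoints ∧ OnPathAV SpreadFromZariskiDenseCMLocus ∧
      OnPathAV UniformAlgebraicityAtCMPoints :=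
  ⟨spreadFromZariskiDenseCMPoints_of_HC_AV, spreadFromZariskiDenseCMLocus_of_HC_AV,
    Ring2.Deform.uniformAlgebraicityAtCMPoints_of_HC_AV⟩

/-- S_ZD, U_Z, U are exact mod `hF` (spread-1 / deform, by name). [cite: CharlesSchnell2014Notes, Thm. 11.5.11 and Cor. 11.3.6] -/
theorem exactWithCM_spreadAxis (hF : deligne1982_cmDenseMumfordTateFamilies) :
    ExactWithCM SpreadFromZariskiDenseCMPoints ∧ ExactWithCM SpreadFromZariskiDenseCMLocus ∧
      ExactWithCM UniformAlgebraicityAtCMPoints :=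
  ⟨HC_AV_iff_HC_CM_and_spreadZD hF, HC_AV_iff_HC_CM_and_spreadZDLocus hF,
    Ring2.Deform.HC_AV_iff_HC_CM_and_uniform_of_deligne1982 hF⟩

/-- **The Mumford–Tate-family branch**: `(1) ⟹ S_ZD ⟹ U_Z ⟹ U` unconditionally, and `U ⟹ CMToAbelian` mod `hF`.
[cite: CharlesSchnell2014Notes, Conj. 11.3.1 and Thm. 11.5.11] -/
theorem ladder_spreadAxis (hF : deligne1982_cmDenseMumfordTateFamilies) :
    (Hypotheses.AbelianSchemeVHC → SpreadFromZariskiDenseCMPoints) ∧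
      (SpreadFromZariskiDenseCMPoints → SpreadFromZariskiDenseCMLocus) ∧
      (SpreadFromZariskiDenseCMLocus → UniformAlgebraicityAtCMPoints) ∧
      (UniformAlgebraicityAtCMPoints → CMToAbelian) :=
  ⟨spreadFromZariskiDenseCMPoints_of_abelianSchemeVHC, spreadFromZariskiDenseCMLocus_of_spreadFromZariskiDenseCMPoints,
    uniform_of_spreadFromZariskiDenseCMLocus, cmToAbelian_of_closesWithCM (closesWithCM_spreadAxis hF).2.2⟩

/-- Mod `hF` the item IS "under `HC_CM`, U": `ModCM U ↔ CMToAbelian`. [cite: CharlesSchnell2014Notes, Thm. 11.5.11] -/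
theorem modCM_uniform_iff_cmToAbelian (hF : deligne1982_cmDenseMumfordTateFamilies) :
    ModCM UniformAlgebraicityAtCMPoints ↔ CMToAbelian :=
  modCM_iff_cmToAbelian_of_exactWithCM (exactWithCM_spreadAxis hF).2.2

/-! ## §C Where the two branches meet: only modulo `HC_CM` -/

/-- **Cross-branch collapse**: under `HC_CM`, granted Lemme 6.3.1 and Deligne's family fact, the weakest pencil node
CPS_∃, the weakest Mumford–Tate-family node U, André II's (T∃) and deform IV's (2) are pairwise equivalent (all are
`HC_AV`). WITHOUT `HC_CM` no implication between U and CPS_∃ / (T∃) is in the tree, in either direction.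
[cite: Andre1996Motifs, Remarque 2 (p. 33)] [cite: Deligne1982HodgeCycles, Prop. 6.1] -/
theorem crossBranch_collapse_of_HC_CM (h₂₁ : andre1996_cmAnchoredPencil)
    (hF : deligne1982_cmDenseMumfordTateFamilies) (hCM : CMAbelianHodge) :
    (UniformAlgebraicityAtCMPoints ↔ CMAnchoredPencilCMSpreading) ∧
      (UniformAlgebraicityAtCMPoints ↔ CMAnchoredPencilTransport) ∧
      (SpreadFromZariskiDenseCMPoints ↔ Ring2.Deform.CompactAbelianPencilVHC) :=
  ⟨iff_of_exactWithCM_of_HC_CM (exactWithCM_spreadAxis hF).2.2 (exactWithCM_cmSpreading_of_andre1996 h₂₁).1 hCM,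
    iff_of_exactWithCM_of_HC_CM (exactWithCM_spreadAxis hF).2.2
      (exactWithCM_candidates_of_andre1996 h₂₁).2.2.2.2 hCM,
    iff_of_exactWithCM_of_HC_CM (exactWithCM_spreadAxis hF).1 (exactWithCM_candidates_of_andre1996 h₂₁).1 hCM⟩

/-- **Relativised, the branches agree without `HC_CM` as a hypothesis**: mod `h₂₁` and `hF`,
`ModCM CPS_∃ ↔ ModCM U` (both are the item). [folklore] -/
theorem modCM_cmSpreading_iff_modCM_uniform (h₂₁ : andre1996_cmAnchoredPencil)
    (hF : deligne1982_cmDenseMumfordTateFamilies) :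
    ModCM CMAnchoredPencilCMSpreading ↔ ModCM UniformAlgebraicityAtCMPoints :=
  (modCM_cmAnchoredPencilCMSpreading_iff_cmToAbelian h₂₁).trans (modCM_uniform_iff_cmToAbelian hF).symm

/-- Class axis for the two fact-light rows: under `HC_CM`, CPS_∃ (no fact) and U (mod `hF`) close EVERY class target
`HCOnClass 𝒞` of typer1's atlas axis. [cite: Deligne2000, §1] -/
theorem hcOnClass_of_HC_CM_of_weakestNodes (hCM : CMAbelianHodge) (𝒞 : AbelianVariety ℂ → Prop) :
    (CMAnchoredPencilCMSpreading → ClassTargets.HCOnClass 𝒞) ∧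
      (deligne1982_cmDenseMumfordTateFamilies → UniformAlgebraicityAtCMPoints → ClassTargets.HCOnClass 𝒞) :=
  ⟨fun hT ↦ hcOnClass_of_closesWithCM closesWithCM_cmAnchoredPencilCMSpreading hCM hT 𝒞,
    fun hF hU ↦ hcOnClass_of_closesWithCM (closesWithCM_spreadAxis hF).2.2 hCM hU 𝒞⟩

/-! ## Audit

Every theorem above has an OPEN node or `HC_CM` among its hypotheses or inside its conclusion's predicate; nothing
is decided; the on-path audit is part I's `of_onPathAV_of_hodgeConjecture` applied to `onPathAV_cmSpreading` /
`onPathAV_spreadAxis`. -/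

/-- On-path audit: the summit gives CPS_CM, S_ZD, U_Z, U outright and CPS_∃ mod Lemme 6.3.1. [folklore] -/
theorem spreadingNodes_of_hodgeConjecture (h₂₁ : andre1996_cmAnchoredPencil) (hHC : _root_.HodgeConjecture) :
    CMPointedPencilCMSpreading ∧ CMAnchoredPencilCMSpreading ∧ SpreadFromZariskiDenseCMPoints ∧
      SpreadFromZariskiDenseCMLocus ∧ UniformAlgebraicityAtCMPoints :=
  ⟨of_onPathAV_of_hodgeConjecture (onPathAV_cmSpreading h₂₁).1 hHC,
    of_onPathAV_of_hodgeConjecture (onPathAV_cmSpreading h₂₁).2 hHC,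
    of_onPathAV_of_hodgeConjecture onPathAV_spreadAxis.1 hHC,
    of_onPathAV_of_hodgeConjecture onPathAV_spreadAxis.2.1 hHC,
    of_onPathAV_of_hodgeConjecture onPathAV_spreadAxis.2.2 hHC⟩

end Summit.HodgeConjecture.HodgeConjecture.Ring2.AbelianAll
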